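import Summits.Ventures.PercRepro.RankLevelSetLevelSixT15Cell7
import Summits.Ventures.PercRepro.RankLevelSetLevelSixT15Cell8
import Summits.Ventures.PercRepro.RankLevelSetLevelSixT15Cell9
import Summits.Ventures.PercRepro.RankLevelSetLevelSixT15Cell10
import Summits.Ventures.PercRepro.RankLevelSetLevelSixT15Cell11
import Summits.Ventures.PercRepro.RankLevelSetLevelSixT15Cell12
import Summits.Ventures.PercRepro.RankLevelSetLevelSixT15Cell13
import Summits.Ventures.PercRepro.RankLevelSetLevelSixT15Cell14
import Summits.Ventures.PercRepro.RankLevelSetLevelSixT15Cell15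
import Summits.Ventures.PercRepro.RankLevelSetLevelSixT15Cell16
import Summits.Ventures.PercRepro.RankLevelSetLevelSixT15Cell17
import Summits.Ventures.PercRepro.RankLevelSetLevelSixT15Cell18
import Summits.Ventures.PercRepro.RankLevelSetLevelSixT15Cell19
import Summits.Ventures.PercRepro.RankLevelSetLevelSixT15Cell20
import Summits.Ventures.PercRepro.RankLevelSetLevelSixT15Cell21
import Summits.Ventures.PercRepro.RankLevelSetLevelSixT15Cell22
import Summits.Ventures.PercRepro.RankLevelSetLevelSixT15Cell23
import Summits.Ventures.PercRepro.RankLevelSetLevelSixT15Cell24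
import Summits.Ventures.PercRepro.RankLevelSetLevelSixT15Cell25
import Summits.Ventures.PercRepro.RankLevelSetLevelSixT15Cell26
import Summits.Ventures.PercRepro.RankLevelSetLevelSixT15Cell27
import Summits.Ventures.PercRepro.RankLevelSetLevelSixT15Cell28
import Summits.Ventures.PercRepro.RankLevelSetLevelSixT15Cell29
import Summits.Ventures.PercRepro.RankLevelSetLevelSixT15Cell30
import Summits.Ventures.PercRepro.RankLevelSetLevelSixT15Cell31
import Summits.Ventures.PercRepro.RankLevelSetLevelSixT15Cell32
import Summits.Ventures.PercRepro.RankLevelSetLevelSixT15Cell33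
import Summits.Ventures.PercRepro.RankLevelSetLevelSixT15Cell34
import Summits.Ventures.PercRepro.RankLevelSetLevelSixT15Cell35
import Summits.Ventures.PercRepro.RankLevelSetLevelSixT15Cell36
import Summits.Ventures.PercRepro.RankLevelSetLevelSixT15Cell37
import Summits.Ventures.PercRepro.S3MidKeyFifteen
import Summits.Ventures.PercRepro.S3SixWindow
import Summits.Ventures.PercRepro.RankLevelSetLevelFiveLadder

/-!
# PercRepro — THE 15 ROW'S CORE: `c025_core_six_fifteen (d ≥ 7) : RLS M 15 6` — EVERY `e`-FREE CORE OF RANK `15` AT LEVEL `6`, AND THE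
ROW 15 GIVEN THE ROW 16 (p7 g22, S3 feeder; p8's assembly shape; tools/gen_rowP.py)

The core cells `(15, d)`: `7 ≤ d ≤ 37` by the coloop device with the lossy ladder on the natural cells of the rows `15 − k`
(`c025_core_six_fifteen_<d>`), `d ≥ 38` by the middle key (`S3Mid.c025_core_six_midkey_fifteen`, no coloop-freeness needed). Then the
level-5 glue `rls_six_at_of_core 15` on `c025_five_all` (level `5` at `p = 14`) gives level `6` at `p = 15`; with the 16 row
this is the 15 row: **`c025_six_large_fifteen_of_sixteen`**.
Axioms: standard.
-/

open scoped Matroid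

namespace PercRepro

namespace ThmN

variable {α : Type}

/-- **The core cell `(15, d)` at every corank `d ≥ 7`, every `e`-free core.** -/
theorem c025_core_six_fifteen (M : Matroid α) [M.Finite] (d : ℕ) (hd7 : 7 ≤ d)
    (hR : M.eRank = (15 : ℕ∞)) (hn : M.E.ncard = 15 + d)
    (hfree : ∀ e ∈ M.E, ∃ A ⊆ M.E \ {e}, e ∉ M.closure A ∧ e ∉ M.closure ((M.E \ {e}) \ A)) :
    RLS M 15 6 := by
  rcases Nat.lt_or_ge d 38 with hlt | hge
  · interval_cases d
    · exact c025_core_six_fifteen_7 M hR hn hfree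
    · exact c025_core_six_fifteen_8 M hR hn hfree
    · exact c025_core_six_fifteen_9 M hR hn hfree
    · exact c025_core_six_fifteen_10 M hR hn hfree
    · exact c025_core_six_fifteen_11 M hR hn hfree
    · exact c025_core_six_fifteen_12 M hR hn hfree
    · exact c025_core_six_fifteen_13 M hR hn hfree
    · exact c025_core_six_fifteen_14 M hR hn hfree
    · exact c025_core_six_fifteen_15 M hR hn hfree
    · exact c025_core_six_fifteen_16 M hR hn hfree
    · exact c025_core_six_fifteen_17 M hR hn hfree
    · exact c025_core_six_fifteen_18 M hR hn hfree
    · exact c025_core_six_fifteen_19 M hR hn hfree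
    · exact c025_core_six_fifteen_20 M hR hn hfree
    · exact c025_core_six_fifteen_21 M hR hn hfree
    · exact c025_core_six_fifteen_22 M hR hn hfree
    · exact c025_core_six_fifteen_23 M hR hn hfree
    · exact c025_core_six_fifteen_24 M hR hn hfree
    · exact c025_core_six_fifteen_25 M hR hn hfree
    · exact c025_core_six_fifteen_26 M hR hn hfree
    · exact c025_core_six_fifteen_27 M hR hn hfree
    · exact c025_core_six_fifteen_28 M hR hn hfree
    · exact c025_core_six_fifteen_29 M hR hn hfree
    · exact c025_core_six_fifteen_30 M hR hn hfree
    · exact c025_core_six_fifteen_31 M hR hn hfree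
    · exact c025_core_six_fifteen_32 M hR hn hfree
    · exact c025_core_six_fifteen_33 M hR hn hfree
    · exact c025_core_six_fifteen_34 M hR hn hfree
    · exact c025_core_six_fifteen_35 M hR hn hfree
    · exact c025_core_six_fifteen_36 M hR hn hfree
    · exact c025_core_six_fifteen_37 M hR hn hfree
  · exact S3Mid.c025_core_six_midkey_fifteen M d hge hR hn hfree

/-- **THEOREM C₆ AT RANK `15`**: level `6` at `p = 15` for every finite matroid (on level `5` at `p = 14`, `c025_five_all`). -/
theorem c025_six_at_fifteen (M : Matroid α) [M.Finite] : RLS M 15 6 :=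
  rls_six_at_of_core 15 (by norm_num) (fun M _ => c025_five_all M 14 (by norm_num))
    (fun M _ d hd hR hn hfree => c025_core_six_fifteen M d hd hR hn hfree) M

/-- **THE 15 ROW GIVEN THE 16 ROW**: C-025 at level `6` for every `p ≥ 15`, every finite matroid, from the 16 row. -/
theorem c025_six_large_fifteen_of_sixteen (h : ∀ (M : Matroid α) [M.Finite] (p : ℕ), 16 ≤ p → RLS M p 6)
    (M : Matroid α) [M.Finite] (p : ℕ) (hp : 15 ≤ p) : RLS M p 6 := by
  rcases Nat.lt_or_ge p 16 with hlt | hge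
  · have hP : p = 15 := by omega
    subst hP
    exact c025_six_at_fifteen M
  · exact h M p hge

end ThmN

end PercRepro
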